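import Summits.QuantumFields.YangMills.Theorems.BalabanUVNodesK2CornerRoad

/-!
# PORT-1 (prover-ym-nodeO-port-1-g0-0): BY-NAME APPLICABILITY CHECK of the LANDED corner-road module `Theorems/BalabanUVNodesK2CornerRoad.lean` (p599976 ✓ e43e61db611b)
# against plan g82's v6 REGISTERED texts and idea-7 §8.7 ∕ CRIT-2 2f's LINE-2 texts — what a v7 LINE 2 {`stub_u3Triple13K`, `stub_anchorSomeJets13K`, `stub_d1AnchoredJets13`}
# would conclude by ONE tree name.  SCRATCH ∕ EVIDENCE ONLY: the four `stub_…` below are `sorry`ed HERE to exercise the concluders; nothing is registered or claimed by this file;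
# K2⁷ OPEN; nothing of Bałaban asserted; YM mass gap (Clay) NOT proved.
-/

noncomputable section

/-! ## SCRATCH (not filed): BY-NAME APPLICABILITY CHECK against plan g82's v6 registered texts (5a75a2378c79b303 :241 `Window13`, :319 `RunRemAtSomeJets`, :330 `D1AtAnchoredJets`,
VERBATIM) and idea-7 §8.7 ∕ CRIT-2 2f's LINE-2 texts (`U3TripleAtRecord13K` :1509, `AnchorSomeJets13K` :1518, `D1SignShadowingAnchor13K` :1524, VERBATIM with v6's `Window13`). -/
namespace Summit.QuantumFields.YangMills.Cruxes.EndpointGivenBR13SepCoPH.Port1CornerRoadApply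

open Literature.MathematicalPhysics.QuantumFieldTheory.Balaban1983to89
open Literature.MathematicalPhysics.QuantumFieldTheory.Balaban1983to89.T4Continuum (T4Family)
open Literature.MathematicalPhysics.QuantumFieldTheory.Balaban1983to89.Beta.Drift (OneLoopDrift)
open Summit.QuantumFields.YangMills.Theorems.BalabanUVNodesK2JsOfRecord (StepColourData beta0OfJs)
open Summit.QuantumFields.YangMills.Theorems.BalabanUVNodesK2NamedJetsRemAt (ScaleAnchor)
open Summit.QuantumFields.YangMills.Theorems.BalabanUVNodesK2NamedJetsRunRemAt (RunRemAt)
open Summit.QuantumFields.YangMills.Theorems.BalabanUVNodesK2CornerRoad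

open Literature.MathematicalPhysics.QuantumFieldTheory.Balaban1983to89.T4CouplingMatching (ScaleShiftRate HistLipschitz)

/-- v6 :241 verbatim -/
def Window13 (F : T4Family) (θ : Node00.Stage13HParams F 2) (hP : θ.Provisos₁₃SepCoPH F 2) : Prop :=
  ∃ γ₁ : ℝ, 0 < γ₁ ∧ ∀ γ : ℝ, 0 < γ → γ ≤ γ₁ → ∃ P : B12.RunParams, 1 ≤ P.K ∧ ((Node00.datumOfRecord₁₃SepCoPH F 2 θ hP).C P).flow.InInterval γ P.K

/-- v6 :319 verbatim -/
def RunRemAtSomeJets : Prop :=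
  ∀ (F : T4Family) (θ : Node00.Stage13HParams F 2) (hP : θ.Provisos₁₃SepCoPH F 2), (θ.ZhUnity F 2 ∧ θ.SlotsNondegenerate₁₃ F 2) → θ.Admissible F 2 →
    B16.EndStatementBPrinted (Node00.datumOfRecord₁₃SepCoPH F 2 θ hP).C → Window13 F θ hP →
    ∃ κ : StepColourData, RunRemAt F κ θ hP θ.cβ

/-- v6 :330 verbatim -/
def D1AtAnchoredJets : Prop :=
  ∀ (F : T4Family) (κ : StepColourData) (θ : Node00.Stage13HParams F 2) (hP : θ.Provisos₁₃SepCoPH F 2), (θ.ZhUnity F 2 ∧ θ.SlotsNondegenerate₁₃ F 2) → θ.Admissible F 2 →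
    B16.EndStatementBPrinted (Node00.datumOfRecord₁₃SepCoPH F 2 θ hP).C → Window13 F θ hP →
    ScaleAnchor (Node00.datumOfRecord₁₃SepCoPH F 2 θ hP).βfun (fun k => θ.cβ * beta0OfJs F κ k) →
    ∃ A : ℝ, OneLoopDrift (B12Normalization.stepBal 2 F.L) A (beta0OfJs F κ)

/-- sketch :1509 verbatim -/
def U3TripleAtRecord13K : Prop :=
  ∀ (F : T4Family) (θ : Node00.Stage13HParams F 2) (hP : θ.Provisos₁₃SepCoPH F 2), (θ.ZhUnity F 2 ∧ θ.SlotsNondegenerate₁₃ F 2) → θ.Admissible F 2 →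
    B16.EndStatementBPrinted (Node00.datumOfRecord₁₃SepCoPH F 2 θ hP).C → Window13 F θ hP →
      ∃ (c C ρ : ℝ) (Λ : ℕ → ℕ → ℝ), 0 ≤ c ∧ 0 < ρ ∧ ρ < 1 ∧
        ScaleShiftRate c ρ θ.γ (Node00.datumOfRecord₁₃SepCoPH F 2 θ hP).βfun ∧
          HistLipschitz Λ θ.γ (Node00.datumOfRecord₁₃SepCoPH F 2 θ hP).βfun ∧ T4CouplingMatching.FadingMemory C ρ Λ

/-- sketch :1518 verbatim -/
def AnchorSomeJets13K : Prop :=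
  ∀ (F : T4Family) (θ : Node00.Stage13HParams F 2) (hP : θ.Provisos₁₃SepCoPH F 2), (θ.ZhUnity F 2 ∧ θ.SlotsNondegenerate₁₃ F 2) → θ.Admissible F 2 →
    B16.EndStatementBPrinted (Node00.datumOfRecord₁₃SepCoPH F 2 θ hP).C → Window13 F θ hP →
      ∃ κ : StepColourData, ScaleAnchor (Node00.datumOfRecord₁₃SepCoPH F 2 θ hP).βfun (fun k => θ.cβ * beta0OfJs F κ k)

/-- sketch :1524 verbatim -/
def D1SignShadowingAnchor13K : Prop :=
  ∀ (F : T4Family) (κ : StepColourData) (θ : Node00.Stage13HParams F 2) (hP : θ.Provisos₁₃SepCoPH F 2), (θ.ZhUnity F 2 ∧ θ.SlotsNondegenerate₁₃ F 2) → θ.Admissible F 2 →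
    B16.EndStatementBPrinted (Node00.datumOfRecord₁₃SepCoPH F 2 θ hP).C → Window13 F θ hP →
      ScaleAnchor (Node00.datumOfRecord₁₃SepCoPH F 2 θ hP).βfun (fun k => θ.cβ * beta0OfJs F κ k) →
        ∃ e : ℝ, 0 < e ∧ ∃ k₀ : ℕ, ∀ k, k₀ ≤ k → e ≤ beta0OfJs F κ k

/-- would-be v7 stubs (sorried HERE ONLY, scratch) -/
theorem stub_u3Triple13K : U3TripleAtRecord13K := by sorry
/-- scratch -/
theorem stub_anchorSomeJets13K : AnchorSomeJets13K := by sorry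
/-- scratch (v6's registered stub name and text) -/
theorem stub_d1AnchoredJets13 : D1AtAnchoredJets := by sorry
/-- scratch -/
theorem stub_d1Sign13K : D1SignShadowingAnchor13K := by sorry

/-- BY NAME: the corner line closes the crux decl from the three would-be v7 stubs by ONE tree name. -/
example : Summit.QuantumFields.YangMills.Theses.BalabanUVNodes.EndpointGivenBR13SepCoPH :=
  EndpointGivenBR13SepCoPH_of_u3K_anchorK_d1AnchoredK stub_u3Triple13K stub_anchorSomeJets13K stub_d1AnchoredJets13

/-- BY NAME: the sign twin. -/
example : Summit.QuantumFields.YangMills.Theses.BalabanUVNodes.EndpointGivenBR13SepCoPH :=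
  EndpointGivenBR13SepCoPH_of_u3K_anchorK_signK stub_u3Triple13K stub_anchorSomeJets13K stub_d1Sign13K

/-- BY NAME: v6's registered XL stub text `RunRemAtSomeJets` DISCHARGED modulo U3ᴷ + Anchorᴷ. -/
example : RunRemAtSomeJets := runRemAtSomeJetsK_of_u3K_anchorK stub_u3Triple13K stub_anchorSomeJets13K

/-- BY NAME: the converse projection and the sign weakening. -/
example (h : RunRemAtSomeJets) : AnchorSomeJets13K := anchorK_of_runRemAtSomeJetsK h
/-- BY NAME -/
example : D1SignShadowingAnchor13K := signK_of_u3K_d1AnchoredK stub_u3Triple13K stub_d1AnchoredJets13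

end Summit.QuantumFields.YangMills.Cruxes.EndpointGivenBR13SepCoPH.Port1CornerRoadApply

end
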